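import Mathlib.RingTheory.FormalGroup.Basic
import Literature.NumberTheory.EllipticCurves.FormalGroupLawAxiomsUniversalProofs
import Literature.NumberTheory.EllipticCurves.FormalGroupMultiplication
import Literature.NumberTheory.EllipticCurves.HasseInvariantTraceProofs
import Literature.NumberTheory.GaloisRepresentations.LubinTateColemanNorm
import HarnessLib

/-!
# The formal group `Ŵ` of a Weierstrass equation as a Mathlib `FormalGroup`, and the group `Ŵ(M)` of its
# points with values in a nil ideal

Topic `Literature/NumberTheory/EllipticCurves`. For a Weierstrass equation `W` over a commutative ring `R` the
chord–tangent law `F_W = W.formalGroupLaw ∈ R⟦z₁, z₂⟧` (tree `FormalGroupLaw.lean`, Silverman AEC IV.1) satisfies the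
formal-group axioms over EVERY ring (tree `FormalGroupLawAxiomsUniversalProofs`: `formalGroupLaw_assoc'`,
`formalGroupLaw_comm'`, `formalGroupLaw_subst_X_zero'`, `formalGroupLaw_subst_X_formalNeg'`). Here:

* `WeierstrassCurve.toFormalGroup W : FormalGroup R` — `F_W` packaged as Mathlib's structure (AEC IV.2.2: "`F` is a formal
  group law"), commutative (`isComm_toFormalGroup`), compatible with base change (`toFormalGroup_map`);
* for `W` over a discrete coefficient ring `A` and a closed nil ideal `M` of a complete linearly topologised
  `A`-algebra `S` (tree `LubinTate.NilIdeal`, e.g. `𝔪_{ℂ_F} ⊂ 𝒪_{ℂ_F}` or `θ⁻¹(𝔪_ℂ) ⊂ 𝔸_inf`): the **group of points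
  `Ŵ(M)`** = `W.Pt M` (a one-field structure wrapping `↥M.toIdeal`) with `P + Q := F_W(P, Q)` (tree `LubinTate.addPt`),
  `-P := i_W(P)` (`W.formalNeg`), `0 := 0`, as an `AddCommGroup` (Cassels–Fröhlich VI §3.2: "under this composition law
  `𝔪_K` is a group which we denote by `F(𝔪_K)`"); `Pt.val_nsmul`: **`n • P = [n]_W(P)`** (`W.formalMul n`, AEC IV.2.3);
* `Pt.map` — a continuous `A`-algebra map `ε : S → T` with `ε(M) ⊆ M'` induces a group homomorphism
  `Ŵ(M) →+ Ŵ(M')` (evaluation commutes with `ε`, tree `LubinTate.algHom_evalPt`).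

This is brick (B9) of the programme `Summits/…/Cruxes/StarredOptimalManinUnitFiveSeven/Lines/kato-lever-hDR-sector-iii-periods.md`
(the Tate module `T_pŴ(𝒪_{ℂ_F})` as an object); no statement about elliptic curves over number fields is proved here.
What is NOT here: the inverse series of a general Mathlib `FormalGroup` (so `Pt` is Weierstrass-specific); the
`ℤ_p`-module structure on `Ŵ(𝔫)` for `(p, ξ)`-adically contracting `[p]`.

## References
* J. H. Silverman, *The Arithmetic of Elliptic Curves* (2009), IV.1–IV.2 (the law, `[m]`, Prop. 2.3), IV.3. [SilvermanAEC2009]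
* J.-P. Serre, *Local class field theory*, Cassels–Fröhlich Ch. VI §3.2 (`F(𝔪_K)`). [CasselsFrohlichANT1967]
* M. Hazewinkel, *Formal Groups and Applications* (1978), §1. [Hazewinkel1978]
-/

noncomputable section

open MvPowerSeries

namespace WeierstrassCurve

/-! ## §1 `F_W` as a Mathlib `FormalGroup` -/

section ToFormalGroup

variable {R : Type*} [CommRing R] (W : WeierstrassCurve R)

/-- The linear coefficient of `z₁` in the chord–tangent law is `1` (any ring): from `F(X, 0) = X`.
[cite: SilvermanAEC2009, IV.2.1] -/
theorem coeff_single_zero_formalGroupLaw_eq_one :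
    MvPowerSeries.coeff (Finsupp.single (0 : Fin 2) 1) W.formalGroupLaw = 1 := by
  have h := congrArg (MvPowerSeries.coeff (Finsupp.single (0 : Fin 2) 1)) W.formalGroupLaw_comm'
  rw [Literature.NumberTheory.GaloisRepresentations.LubinTate.coeff_single_subst
    (fun j => by fin_cases j <;> exact MvPowerSeries.constantCoeff_X _), Fin.sum_univ_two] at h
  simp only [Matrix.cons_val_zero, Matrix.cons_val_one, MvPowerSeries.coeff_X, Finsupp.single_eq_single_iff,
    W.coeff_single_one_formalGroupLaw_eq_one] at h
  simpa using h.symm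

/-- **The formal group `Ŵ` of a Weierstrass equation** as a Mathlib one-dimensional formal group law: the
chord–tangent series `F_W(z₁, z₂)` with `F(X,Y) = X + Y + …` and `F(F(X,Y),Z) = F(X,F(Y,Z))` (the tree's ring-general
axioms `formalGroupLaw_assoc'`, linear coefficients `1`). [cite: SilvermanAEC2009, IV.2.2] -/
def toFormalGroup : FormalGroup R where
  toPowerSeries := W.formalGroupLaw
  zero_constantCoeff := W.constantCoeff_formalGroupLaw
  lin_coeff_X := W.coeff_single_zero_formalGroupLaw_eq_one
  lin_coeff_Y := W.coeff_single_one_formalGroupLaw_eq_one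
  assoc := W.formalGroupLaw_assoc'

/-- Unfolding: the series of `Ŵ` is the chord–tangent law. [cite: SilvermanAEC2009, IV.2.2] -/
@[simp] theorem toFormalGroup_toPowerSeries : W.toFormalGroup.toPowerSeries = W.formalGroupLaw := rfl

/-- **`Ŵ` is commutative**: `F_W(X, Y) = F_W(Y, X)`. [cite: SilvermanAEC2009, IV.2.1] -/
instance isComm_toFormalGroup : W.toFormalGroup.IsComm := ⟨W.formalGroupLaw_comm'.symm⟩

/-- `Ŵ` commutes with base change: `(W ⊗ φ)^ = φ_* Ŵ`. [cite: SilvermanAEC2009, IV.2.2] -/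
theorem toFormalGroup_map {S : Type*} [CommRing S] (φ : R →+* S) :
    (W.map φ).toFormalGroup = W.toFormalGroup.map φ := by
  ext1
  change (W.map φ).formalGroupLaw = MvPowerSeries.map φ W.formalGroupLaw
  rw [W.map_formalGroupLaw]

end ToFormalGroup

/-! ## §2 The group `Ŵ(M)` of points with values in a nil ideal -/

section PtDef

variable {A : Type*} {S : Type*} [CommRing S] [UniformSpace S]

open Literature.NumberTheory.GaloisRepresentations.LubinTate in
/-- **A point of `Ŵ` with values in the nil ideal `M`**: an element of `M` (one-field wrapper, so that the
formal-group addition does not collide with the ring addition of `M`; the equation `W` is a phantom parameter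
selecting the group law). [cite: CasselsFrohlichANT1967, Ch. VI §3.2] -/
@[ext] structure Pt (W : WeierstrassCurve A) (M : Literature.NumberTheory.GaloisRepresentations.LubinTate.NilIdeal S) where
  /-- the underlying element of `M` [folklore] -/
  val : M.toIdeal

namespace Pt

variable {W : WeierstrassCurve A} {M : Literature.NumberTheory.GaloisRepresentations.LubinTate.NilIdeal S}

/-- `Pt.val` is injective (a point is its coordinate in `M`). [cite: CasselsFrohlichANT1967, Ch. VI §3.2] -/
theorem val_injective : Function.Injective (Pt.val : W.Pt M → M.toIdeal) := fun _ _ h => Pt.ext h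

/-- The origin `0 ∈ M`. [cite: CasselsFrohlichANT1967, Ch. VI §3.2] -/
instance instZero : Zero (W.Pt M) := ⟨⟨0⟩⟩

/-- Unfolding `0`: the origin of `Ŵ(M)` is `0 ∈ M`. [cite: CasselsFrohlichANT1967, Ch. VI §3.2] -/
@[simp] theorem val_zero : (0 : W.Pt M).val = 0 := rfl

/-- `P = 0 ↔ P.val = 0`. [cite: CasselsFrohlichANT1967, Ch. VI §3.2] -/
theorem eq_zero_iff (P : W.Pt M) : P = 0 ↔ P.val = 0 :=
  ⟨fun h => by rw [h, val_zero], fun h => Pt.ext h⟩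

end Pt

end PtDef

section Points

open Literature.NumberTheory.GaloisRepresentations.LubinTate

variable {A : Type*} [CommRing A] [UniformSpace A] [DiscreteUniformity A]
variable {S : Type*} [CommRing S] [UniformSpace S] [IsUniformAddGroup S] [IsTopologicalRing S]
  [IsLinearTopology S S] [T2Space S] [CompleteSpace S] [Algebra A S] [ContinuousSMul A S]

namespace Pt

variable {W : WeierstrassCurve A} {M : NilIdeal S}

variable (M) in
/-- Evaluating the zero series gives `0`. [cite: CasselsFrohlichANT1967, Ch. VI §3.2] -/
theorem evalPt_zero_series {ι : Type*} [Finite ι] (x : ι → M.toIdeal)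
    (h0 : (0 : MvPowerSeries ι A).constantCoeff = 0) : evalPt M (0 : MvPowerSeries ι A) h0 x = 0 :=
  Subtype.ext (by rw [coe_evalPt, map_zero]; rfl)

variable (W) in
/-- `F_W(P, 0) = P` on points (from `F(X, 0) = X`). [cite: CasselsFrohlichANT1967, Ch. VI §3.2] -/
theorem addPt_zero (x : M.toIdeal) : addPt M W.toFormalGroup x 0 = x := by
  have h2 : ∀ s : Fin 2, ((![PowerSeries.X, 0] : Fin 2 → MvPowerSeries Unit A) s).constantCoeff = 0 :=
    fun s => by fin_cases s <;> simp [PowerSeries.X]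
  have e := evalPt_congr M W.formalGroupLaw_subst_X_zero' (constantCoeff_subst_zero h2 W.constantCoeff_formalGroupLaw)
    PowerSeries.constantCoeff_X (fun _ => x)
  rw [evalPt_subst M h2 _ W.constantCoeff_formalGroupLaw] at e
  have hX : evalPt M (PowerSeries.X : MvPowerSeries Unit A) PowerSeries.constantCoeff_X (fun _ => x) = x :=
    evalPt_X M () (fun _ => x)
  rw [hX] at e
  conv_rhs => rw [← e]
  change evalPt M W.formalGroupLaw W.constantCoeff_formalGroupLaw ![x, 0] = _
  congr 1
  funext s
  fin_cases s
  · exact hX.symm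
  · exact (evalPt_zero_series M _ (h2 1)).symm

variable (W) in
/-- `F_W(P, i_W(P)) = 0` on points (from `F(X, i(X)) = 0`). [cite: SilvermanAEC2009, IV.2.1] -/
theorem addPt_formalNeg (x : M.toIdeal) :
    addPt M W.toFormalGroup x (evalPt₁ M W.formalNeg W.constantCoeff_formalNeg x) = 0 := by
  have h2 : ∀ s : Fin 2, ((![PowerSeries.X, W.formalNeg] : Fin 2 → MvPowerSeries Unit A) s).constantCoeff = 0 :=
    fun s => by
      fin_cases s
      · simp [PowerSeries.X]
      · exact W.constantCoeff_formalNeg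
  have e := evalPt_congr M W.formalGroupLaw_subst_X_formalNeg'
    (constantCoeff_subst_zero h2 W.constantCoeff_formalGroupLaw) (map_zero _) (fun _ => x)
  rw [evalPt_subst M h2 _ W.constantCoeff_formalGroupLaw, evalPt_zero_series] at e
  refine Eq.trans ?_ e
  change evalPt M W.formalGroupLaw W.constantCoeff_formalGroupLaw ![x, _] = _
  congr 1
  funext s
  fin_cases s
  · exact (evalPt_X M () (fun _ => x)).symm
  · rfl

variable (W) in
/-- **`[n+1]_W(x) = F_W([n]_W(x), x)` on points** (the recursion `[n+1] = F([n], X)` transported by evaluation).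
[cite: SilvermanAEC2009, IV.2.3] -/
theorem evalPt₁_formalMul_succ (n : ℕ) (x : M.toIdeal) :
    evalPt₁ M (W.formalMul (n + 1)) (W.constantCoeff_formalMul (n + 1)) x =
      addPt M W.toFormalGroup (evalPt₁ M (W.formalMul n) (W.constantCoeff_formalMul n) x) x := by
  have ha : ∀ s : Fin 2, MvPowerSeries.constantCoeff
      ((![(W.formalMul n : MvPowerSeries Unit A), PowerSeries.X] : Fin 2 → MvPowerSeries Unit A) s) = 0 := by
    intro s
    fin_cases s
    · exact W.constantCoeff_formalMul n
    · exact PowerSeries.constantCoeff_X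
  have e := evalPt_subst M ha W.formalGroupLaw W.constantCoeff_formalGroupLaw
    (constantCoeff_subst_zero ha W.constantCoeff_formalGroupLaw) (fun _ => x)
  refine Eq.trans ?_ (e.trans ?_)
  · rfl
  · change evalPt M W.formalGroupLaw _ _ = evalPt M W.formalGroupLaw _ ![_, x]
    congr 1
    funext s
    fin_cases s
    · rfl
    · exact evalPt_X M () (fun _ => x)

/-- The formal-group sum `F_W(P, Q)` of two points. [cite: CasselsFrohlichANT1967, Ch. VI §3.2] -/
instance instAdd : Add (W.Pt M) := ⟨fun P Q => ⟨addPt M W.toFormalGroup P.val Q.val⟩⟩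

/-- The formal inverse `i_W(P)` of a point. [cite: SilvermanAEC2009, IV.1.1] -/
instance instNeg : Neg (W.Pt M) := ⟨fun P => ⟨evalPt₁ M W.formalNeg W.constantCoeff_formalNeg P.val⟩⟩

/-- Unfolding `+`: `(P + Q).val = F_W(P.val, Q.val)`. [cite: CasselsFrohlichANT1967, Ch. VI §3.2] -/
theorem val_add (P Q : W.Pt M) : (P + Q).val = addPt M W.toFormalGroup P.val Q.val := rfl

/-- Unfolding `+` down to the series: `(P + Q).val = F_W(P.val, Q.val)` as an evaluation of `W.formalGroupLaw`.
[cite: CasselsFrohlichANT1967, Ch. VI §3.2] -/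
theorem val_add_eq_evalPt (P Q : W.Pt M) :
    (P + Q).val = evalPt M W.formalGroupLaw W.constantCoeff_formalGroupLaw ![P.val, Q.val] := rfl

/-- Unfolding `-`: `(-P).val = i_W(P.val)`. [cite: SilvermanAEC2009, IV.1.1] -/
theorem val_neg (P : W.Pt M) : (-P).val = evalPt₁ M W.formalNeg W.constantCoeff_formalNeg P.val := rfl

/-- **`Ŵ(M)` is an abelian group** under `P + Q := F_W(P, Q)`, `-P := i_W(P)`, `0 := 0` (associativity and
commutativity from the tree's `addPt_assoc` / `addPt_comm`, i.e. from `formalGroupLaw_assoc'` / `_comm'`).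
[cite: CasselsFrohlichANT1967, Ch. VI §3.2] -/
instance instAddCommGroup : AddCommGroup (W.Pt M) where
  add := (· + ·)
  zero := 0
  neg := Neg.neg
  nsmul := nsmulRec
  zsmul := zsmulRec
  add_assoc P Q R := Pt.ext (addPt_assoc M W.toFormalGroup P.val Q.val R.val)
  add_comm P Q := Pt.ext (addPt_comm M W.toFormalGroup P.val Q.val)
  add_zero P := Pt.ext (addPt_zero W P.val)
  zero_add P := Pt.ext (by rw [val_add, addPt_comm, val_zero, addPt_zero])
  neg_add_cancel P := Pt.ext (by rw [val_add, addPt_comm, val_neg, addPt_formalNeg, val_zero])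

/-- **`n • P = [n]_W(P)`**: the `n`-th multiple in `Ŵ(M)` is the evaluation of the multiplication-by-`n` series
(`[0] = 0`, `[n+1] = F([n], X)`). [cite: SilvermanAEC2009, IV.2.3] -/
theorem val_nsmul (n : ℕ) (P : W.Pt M) :
    (n • P).val = evalPt₁ M (W.formalMul n) (W.constantCoeff_formalMul n) P.val := by
  induction n with
  | zero =>
    rw [zero_nsmul, val_zero]
    exact (evalPt_zero_series M (fun _ : Unit => P.val) (map_zero _)).symm
  | succ n ih => rw [succ_nsmul, val_add, ih, evalPt₁_formalMul_succ]

/-- A point is killed by `n` in `Ŵ(M)` iff it is a zero of `[n]_W`. [cite: SilvermanAEC2009, IV.2.3] -/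
theorem nsmul_eq_zero_iff (n : ℕ) (P : W.Pt M) :
    n • P = 0 ↔ evalPt₁ M (W.formalMul n) (W.constantCoeff_formalMul n) P.val = 0 := by
  rw [eq_zero_iff, val_nsmul]

/-! ### Functoriality in the coefficient algebra -/

variable {T : Type*} [CommRing T] [UniformSpace T] [IsUniformAddGroup T] [IsTopologicalRing T]
  [IsLinearTopology T T] [T2Space T] [CompleteSpace T] [Algebra A T] [ContinuousSMul A T]
  {M' : NilIdeal T}

variable (W M M') in
/-- **Functoriality of `Ŵ(·)`**: a continuous `A`-algebra map `ε : S → T` with `ε(M) ⊆ M'` induces the group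
homomorphism `Ŵ(M) → Ŵ(M')`, `P ↦ ε(P)` (evaluation of `F_W` commutes with `ε`). [cite: CasselsFrohlichANT1967, Ch. VI §3.2] -/
def map (ε : S →ₐ[A] T) (hε : Continuous ε) (hM : ∀ x ∈ M.toIdeal, ε x ∈ M'.toIdeal) : W.Pt M →+ W.Pt M' where
  toFun P := ⟨⟨ε P.val, hM _ P.val.2⟩⟩
  map_zero' := Pt.ext (Subtype.ext (by change ε ((0 : M.toIdeal) : S) = ((0 : M'.toIdeal) : T); simp))
  map_add' P Q := Pt.ext (Subtype.ext
    (algHom_evalPt M M' ε hε W.toFormalGroup.toPowerSeries W.toFormalGroup.zero_constantCoeff ![P.val, Q.val]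
      ![⟨ε P.val, hM _ P.val.2⟩, ⟨ε Q.val, hM _ Q.val.2⟩] (fun i => by fin_cases i <;> rfl)))

/-- Unfolding `Pt.map`: `ε` acts on the coordinate. [cite: CasselsFrohlichANT1967, Ch. VI §3.2] -/
@[simp] theorem coe_val_map (ε : S →ₐ[A] T) (hε : Continuous ε) (hM : ∀ x ∈ M.toIdeal, ε x ∈ M'.toIdeal) (P : W.Pt M) :
    ((map W M M' ε hε hM P).val : T) = ε P.val := rfl

/-- `Pt.map` commutes with every evaluation: `ε(h(P)) = h(ε P)` for a constant-term-free series `h` over `A`.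
[cite: CasselsFrohlichANT1967, Ch. VI §3.2] -/
theorem map_evalPt₁ (ε : S →ₐ[A] T) (hε : Continuous ε) (hM : ∀ x ∈ M.toIdeal, ε x ∈ M'.toIdeal)
    (h : PowerSeries A) (hh : PowerSeries.constantCoeff h = 0) (P : W.Pt M) :
    map W M M' ε hε hM (⟨evalPt₁ M h hh P.val⟩ : W.Pt M) = (⟨evalPt₁ M' h hh (map W M M' ε hε hM P).val⟩ : W.Pt M') :=
  Pt.ext (Subtype.ext (algHom_evalPt M M' ε hε (h : MvPowerSeries Unit A) hh (fun _ => P.val)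
    (fun _ => ⟨ε P.val, hM _ P.val.2⟩) fun _ => rfl))

/-- `Pt.map` of the identity is the identity (functoriality of `Ŵ(·)`). [cite: CasselsFrohlichANT1967, Ch. VI §3.2] -/
theorem map_id (P : W.Pt M) : map W M M (AlgHom.id A S) continuous_id (fun _ hx => hx) P = P :=
  Pt.ext (Subtype.ext rfl)

variable {U : Type*} [CommRing U] [UniformSpace U] [IsUniformAddGroup U] [IsTopologicalRing U]
  [IsLinearTopology U U] [T2Space U] [CompleteSpace U] [Algebra A U] [ContinuousSMul A U]
  {M'' : NilIdeal U}

/-- `Pt.map` is compatible with composition (functoriality of `Ŵ(·)`). [cite: CasselsFrohlichANT1967, Ch. VI §3.2] -/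
theorem map_comp (ε : S →ₐ[A] T) (hε : Continuous ε) (hM : ∀ x ∈ M.toIdeal, ε x ∈ M'.toIdeal)
    (δ : T →ₐ[A] U) (hδ : Continuous δ) (hM' : ∀ x ∈ M'.toIdeal, δ x ∈ M''.toIdeal) (P : W.Pt M) :
    map W M' M'' δ hδ hM' (map W M M' ε hε hM P) =
      map W M M'' (δ.comp ε) (hδ.comp hε) (fun x hx => hM' _ (hM x hx)) P :=
  Pt.ext (Subtype.ext rfl)

end Pt

end Points

end WeierstrassCurve

end
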